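import Literature.Probability.LatticeModels.SRWStepSequences
import Mathlib.Algebra.Order.Chebyshev
import Mathlib.Algebra.BigOperators.Field
import Mathlib.Data.Real.Basic
import Mathlib.Tactic.Positivity
import Mathlib.Tactic.FieldSimp
import Mathlib.Tactic.Ring
import HarnessLib

/-!
# Endpoint counts of the simple random walk on `ℤ^d`: convolution, symmetry, maximum principle

Companion to `SRWStepSequences.lean` (namespace `Literature.Probability.LatticeModels.SRW`). For
`count d n x = #{ω : Fin n → Dir d | ω(n) = x}` (so `pₙ(x) = P(Sₙ = x) = count d n x / (2d)^n`,
here `prob d n x`) we prove the folklore identities and inequalities that drive second-moment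
computations for the simple random walk (Spitzer 1976, §1 and P7.6; Lawler–Limic 2010, §1.1,
§2.4):

* splitting by Mathlib's `(Fin.appendEquiv a b).symm : StepSeq d (a+b) ≃ StepSeq d a × StepSeq d b`
  (`endpoint_append`) and the **Chapman–Kolmogorov / convolution identity** `count_add`:
  `count (a+b) x = Σ_y count a y · count b (x - y)`;
* the first-step form `count_one_add`: `count (1+m) x = Σ_v count m (x - e_v)`;
* `sum_box_count_sq`: `Σ_y count m y ² = count (m+m) 0` (negation symmetry `count_neg`);
* the **maximum principle** `count_add_self_le`: `count (m+m) x ≤ count (m+m) 0`, its odd-time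
  form `count_one_add_add_self_le`, and the **monotonicity** of the even return counts
  `count_succ_add_succ_le`: `count ((m+1)+(m+1)) 0 ≤ (2d)² count (m+m) 0` (Cauchy–Schwarz);
* the same statements for the probabilities `prob d n x = count d n x / (2d)^n`:
  `prob_add`, `prob_le_prob_even` (`pₙ(x) ≤ p_{2k}(0)` for `2k ≤ n`), `sum_box_prob`.

## Prior encodings of the `n`-step law in the tree (to be retargeted here)

The transition probability `prob d n x = P(Sₙ = x)` is NOT new in the tree; it is the encoding
placed at the `LatticeModels` layer (below `Barriers`, which opens `LatticeModels`), and the two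
existing encodings are to be identified with it by a librarian `refactor:` follow-up, in a file
importing both sides:

* `Literature.Barriers.CriticalPhenomena.LongRangePhi4.srwLaw`
  (`Barriers/CriticalPhenomena/RigorousRGSmallParameterFracLaplacian.lean`), defined by the
  recursion `p₀ = δ₀`, `p_{n+1}(x) = (2d)⁻¹ Σⱼ (pₙ(x+eⱼ) + pₙ(x-eⱼ))`; it agrees with `prob d n x`
  for every `d, n, x` (including the junk value `0` for `d = 0`, `n ≥ 1`) — the glue is one
  induction on `n` through `count_one_add` (first-step decomposition) and the splitting
  `Dir d = Fin d × Bool` of the `2d` steps into `±eⱼ`;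
* `convPow (srwStep d) n` with `srwStep d = 𝟙{|x| = 1}/(2d)`
  (`Barriers/CriticalPhenomena/GaussianDominationRouteNoble.lean`), the same law as an `n`-fold
  convolution power.

All fully proved; nothing here depends on the dimension.
-/

noncomputable section

open Finset

namespace Literature.Probability.LatticeModels

namespace SRW

variable {d : ℕ}

/-! ### Splitting a walk into two pieces (Mathlib's `Fin.appendEquiv`) -/

/-- The endpoint of a concatenation is the sum of the endpoints: splitting an `(a+b)`-step
sequence by Mathlib's `(Fin.appendEquiv a b).symm` into its first `a` and last `b` steps.
[folklore] -/
theorem endpoint_eq_add_appendEquiv_symm {a b : ℕ} (ω : StepSeq d (a + b)) :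
    endpoint ω = endpoint ((Fin.appendEquiv a b).symm ω).1 + endpoint ((Fin.appendEquiv a b).symm ω).2 := by
  unfold endpoint
  rw [Fin.sum_univ_add]
  rfl

/-- The endpoint of `Fin.append α β` is `α(a) + β(b)`. [folklore] -/
theorem endpoint_append {a b : ℕ} (α : StepSeq d a) (β : StepSeq d b) :
    endpoint (Fin.append α β : StepSeq d (a + b)) = endpoint α + endpoint β := by
  unfold endpoint
  rw [Fin.sum_univ_add]
  simp

/-! ### Convolution identities -/

/-- **Chapman–Kolmogorov** for the counts: `count (a+b) x = Σ_{y ∈ box d a} count a y · count b (x-y)`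
(the walk is at some `y` after `a` steps). [folklore] -/
theorem count_add (a b : ℕ) (x : Site d) :
    count d (a + b) x = ∑ y ∈ box d a, count d a y * count d b (x - y) := by
  classical
  rw [count_eq_sum_ite, ← (Fin.appendEquiv (α := Dir d) a b).sum_comp, Fintype.sum_prod_type]
  have h : ∀ α : StepSeq d a, (∑ β : StepSeq d b,
      if endpoint (Fin.appendEquiv a b (α, β)) = x then 1 else 0) = count d b (x - endpoint α) := by
    intro α
    rw [count_eq_sum_ite]
    refine Finset.sum_congr rfl fun β _ => ?_
    have : Fin.appendEquiv a b (α, β) = Fin.append α β := rfl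
    rw [this, endpoint_append]
    congr 1
    exact propext ⟨fun h => by rw [← h]; abel, fun h => by rw [h]; abel⟩
  simp_rw [h]
  rw [sum_stepSeq_eq_sum_box_count (fun y => count d b (x - y))]
  simp

/-- The one-step count is the indicator of the unit steps: `Σ_y count 1 y • f y = Σ_v f(e_v)`
(ℕ-scalar action on an additive monoid). [folklore] -/
theorem sum_box_count_one_smul {M : Type*} [AddCommMonoid M] (f : Site d → M) :
    ∑ y ∈ box d 1, count d 1 y • f y = ∑ v : Dir d, f (stepVec v) := by
  rw [← sum_stepSeq_eq_sum_box_count f]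
  rw [← (Equiv.funUnique (Fin 1) (Dir d)).symm.sum_comp]
  refine Finset.sum_congr rfl fun v _ => ?_
  simp [endpoint]

/-- **First-step decomposition**: `count (1+m) x = Σ_v count m (x - e_v)`. [folklore] -/
theorem count_one_add (m : ℕ) (x : Site d) :
    count d (1 + m) x = ∑ v : Dir d, count d m (x - stepVec v) := by
  rw [count_add 1 m x]
  have h := sum_box_count_one_smul (d := d) (M := ℕ) (fun y => count d m (x - y))
  simpa [smul_eq_mul] using h

/-- `Σ_{y ∈ box d m} count m y ² = count (m+m) 0`: the number of pairs of `m`-step walks with the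
same endpoint (negation symmetry). [folklore] -/
theorem sum_box_count_sq (m : ℕ) : ∑ y ∈ box d m, count d m y ^ 2 = count d (m + m) 0 := by
  rw [count_add m m 0]
  refine Finset.sum_congr rfl fun y _ => ?_
  rw [zero_sub, count_neg, sq]

/-! ### Support bookkeeping -/

/-- A sum of a function supported in `box d k`, precomposed with an injection, is at most its
sum over the box. [folklore] -/
theorem sum_comp_le_sum_box {g : Site d → ℕ} {k : ℕ} (hg : ∀ w ∉ box d k, g w = 0)
    {φ : Site d → Site d} (hφ : Function.Injective φ) (s : Finset (Site d)) :
    ∑ z ∈ s, g (φ z) ≤ ∑ w ∈ box d k, g w := by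
  classical
  rw [← Finset.sum_image (f := g) (fun z _ z' _ h => hφ h)]
  calc ∑ w ∈ s.image φ, g w = ∑ w ∈ (s.image φ).filter (· ∈ box d k), g w := by
        rw [Finset.sum_filter]
        refine Finset.sum_congr rfl fun w _ => ?_
        split_ifs with hw
        · rfl
        · exact hg w hw
    _ ≤ ∑ w ∈ box d k, g w :=
        Finset.sum_le_sum_of_subset (by intro w hw; exact (Finset.mem_filter.1 hw).2)

/-- Translates of the squared count, summed over any finset, are at most the full sum of squares:
`Σ_{z ∈ s} count m (z - y)² ≤ Σ_{box m} count m ² = count (m+m) 0`. [folklore] -/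
theorem sum_count_sub_sq_le (m : ℕ) (y : Site d) (s : Finset (Site d)) :
    ∑ z ∈ s, count d m (z - y) ^ 2 ≤ count d (m + m) 0 := by
  rw [← sum_box_count_sq]
  exact sum_comp_le_sum_box (g := fun w => count d m w ^ 2)
    (fun w hw => by rw [count_eq_zero_of_not_mem_box hw]; simp) (sub_left_injective) s

/-! ### Maximum principle and monotonicity -/

/-- **Maximum principle** at even times: `count (m+m) x ≤ count (m+m) 0` (Cauchy–Schwarz in the
convolution identity). [folklore] -/
theorem count_add_self_le (m : ℕ) (x : Site d) : count d (m + m) x ≤ count d (m + m) 0 := by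
  have hcs := sum_mul_sq_le_sq_mul_sq (box d m) (fun y => count d m y) (fun y => count d m (x - y))
  rw [← count_add m m x, sum_box_count_sq] at hcs
  have h2 : ∑ y ∈ box d m, count d m (x - y) ^ 2 ≤ count d (m + m) 0 := by
    have := sum_comp_le_sum_box (g := fun w => count d m w ^ 2) (k := m)
      (fun w hw => by rw [count_eq_zero_of_not_mem_box hw]; simp) (φ := fun w => x - w)
      sub_right_injective (box d m)
    rwa [sum_box_count_sq] at this
  have h : count d (m + m) x ^ 2 ≤ count d (m + m) 0 ^ 2 :=
    hcs.trans (by rw [sq]; exact Nat.mul_le_mul_left _ h2)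
  exact (Nat.pow_le_pow_iff_left (by norm_num)).1 h

/-- Maximum principle at odd times: `count (1+(m+m)) x ≤ 2d · count (m+m) 0`. [folklore] -/
theorem count_one_add_add_self_le (m : ℕ) (x : Site d) :
    count d (1 + (m + m)) x ≤ 2 * d * count d (m + m) 0 := by
  rw [count_one_add]
  calc ∑ v : Dir d, count d (m + m) (x - stepVec v)
      ≤ ∑ _v : Dir d, count d (m + m) 0 := Finset.sum_le_sum fun v _ => count_add_self_le m _
    _ = 2 * d * count d (m + m) 0 := by
      rw [Finset.sum_const, Finset.card_univ, card_dir, smul_eq_mul]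

/-- **Monotonicity of even return counts**: `count ((m+1)+(m+1)) 0 ≤ (2d)² · count (m+m) 0`, i.e.
`p_{2m+2}(0) ≤ p_{2m}(0)` (the squared `ℓ²` norm of `pₘ` is non-increasing). [folklore] -/
theorem count_succ_add_succ_le (m : ℕ) :
    count d (m + 1 + (m + 1)) 0 ≤ (2 * d) ^ 2 * count d (m + m) 0 := by
  rw [← sum_box_count_sq (m + 1)]
  have hstep : ∀ z : Site d, count d (m + 1) z ^ 2 ≤
      2 * d * ∑ v : Dir d, count d m (z - stepVec v) ^ 2 := by
    intro z
    rw [show m + 1 = 1 + m from Nat.add_comm m 1, count_one_add]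
    have h := sq_sum_le_card_mul_sum_sq (s := (Finset.univ : Finset (Dir d)))
      (f := fun v => count d m (z - stepVec v))
    rwa [Finset.card_univ, card_dir] at h
  calc ∑ z ∈ box d (m + 1), count d (m + 1) z ^ 2
      ≤ ∑ z ∈ box d (m + 1), 2 * d * ∑ v : Dir d, count d m (z - stepVec v) ^ 2 :=
        Finset.sum_le_sum fun z _ => hstep z
    _ = 2 * d * ∑ v : Dir d, ∑ z ∈ box d (m + 1), count d m (z - stepVec v) ^ 2 := by
        rw [← Finset.mul_sum, Finset.sum_comm]
    _ ≤ 2 * d * ∑ _v : Dir d, count d (m + m) 0 := by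
        refine Nat.mul_le_mul_left _ (Finset.sum_le_sum fun v _ => ?_)
        exact sum_count_sub_sq_le m (stepVec v) _
    _ = (2 * d) ^ 2 * count d (m + m) 0 := by
        rw [Finset.sum_const, Finset.card_univ, card_dir, smul_eq_mul]; ring

/-- Iterated monotonicity: `count (k+k) 0 · (2d)^{2j} ≥ count ((k+j)+(k+j)) 0`, i.e.
`p_{2(k+j)}(0) ≤ p_{2k}(0)`. [folklore] -/
theorem count_add_add_le (k j : ℕ) :
    count d (k + j + (k + j)) 0 ≤ (2 * d) ^ (2 * j) * count d (k + k) 0 := by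
  induction j with
  | zero => simp
  | succ j ih =>
      calc count d (k + (j + 1) + (k + (j + 1))) 0
          = count d (k + j + 1 + (k + j + 1)) 0 := by ring_nf
        _ ≤ (2 * d) ^ 2 * count d (k + j + (k + j)) 0 := count_succ_add_succ_le (k + j)
        _ ≤ (2 * d) ^ 2 * ((2 * d) ^ (2 * j) * count d (k + k) 0) := Nat.mul_le_mul_left _ ih
        _ = (2 * d) ^ (2 * (j + 1)) * count d (k + k) 0 := by ring

/-! ### Probabilities -/

/-- `prob d n x = P(Sₙ = x) = count d n x / (2d)^n` for the simple random walk on `ℤ^d` (for `d = 0`,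
`n ≥ 1` this is the junk value `0`). The same law is encoded higher in the tree as
`Literature.Barriers.CriticalPhenomena.LongRangePhi4.srwLaw` (first-step recursion) and as
`convPow (srwStep d) n` (`GaussianDominationRouteNoble.lean`); both are to be retargeted to this
definition (see the module docstring). [folklore] -/
def prob (d n : ℕ) (x : Site d) : ℝ := count d n x / (2 * d : ℝ) ^ n

/-- `pₙ(x) ≥ 0`. [folklore] -/
theorem prob_nonneg (n : ℕ) (x : Site d) : 0 ≤ prob d n x := by
  unfold prob; positivity

/-- `pₙ` vanishes off `box d n`. [folklore] -/
theorem prob_eq_zero_of_not_mem_box {n : ℕ} {x : Site d} (hx : x ∉ box d n) : prob d n x = 0 := by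
  simp [prob, count_eq_zero_of_not_mem_box hx]

/-- Total mass `Σ_{x ∈ box d n} pₙ(x) = 1` (`d ≥ 1`). [folklore] -/
theorem sum_box_prob (hd : 0 < d) (n : ℕ) : ∑ x ∈ box d n, prob d n x = 1 := by
  unfold prob
  rw [← Finset.sum_div, ← Nat.cast_sum, sum_box_count]
  have : (2 * d : ℝ) ^ n ≠ 0 := by positivity
  rw [Nat.cast_pow, Nat.cast_mul, Nat.cast_two, div_self this]

/-- `pₙ(x) ≤ 1` (`d ≥ 1`). [folklore] -/
theorem prob_le_one (hd : 0 < d) (n : ℕ) (x : Site d) : prob d n x ≤ 1 := by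
  by_cases hx : x ∈ box d n
  · rw [← sum_box_prob hd n]
    exact Finset.single_le_sum (fun y _ => prob_nonneg n y) hx
  · rw [prob_eq_zero_of_not_mem_box hx]; exact zero_le_one

/-- `p₀(x) = [x = 0]`. [folklore] -/
theorem prob_zero (x : Site d) : prob d 0 x = if x = 0 then 1 else 0 := by
  unfold prob; rw [count_zero]; split_ifs <;> simp

/-- Negation symmetry `pₙ(-x) = pₙ(x)`. [folklore] -/
theorem prob_neg (n : ℕ) (x : Site d) : prob d n (-x) = prob d n x := by
  unfold prob; rw [count_neg]

/-- **Chapman–Kolmogorov**: `p_{a+b}(x) = Σ_{y ∈ box d a} p_a(y) p_b(x-y)`. [folklore] -/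
theorem prob_add (a b : ℕ) (x : Site d) :
    prob d (a + b) x = ∑ y ∈ box d a, prob d a y * prob d b (x - y) := by
  unfold prob
  rw [count_add, Nat.cast_sum, Finset.sum_div]
  refine Finset.sum_congr rfl fun y _ => ?_
  rw [Nat.cast_mul, pow_add]
  ring

/-- **Maximum principle**, even times: `p_{m+m}(x) ≤ p_{m+m}(0)`. [folklore] -/
theorem prob_add_self_le (m : ℕ) (x : Site d) : prob d (m + m) x ≤ prob d (m + m) 0 := by
  unfold prob
  exact div_le_div_of_nonneg_right (by exact_mod_cast count_add_self_le m x) (by positivity)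

/-- Maximum principle, odd times: `p_{1+(m+m)}(x) ≤ p_{m+m}(0)` (`d ≥ 1`). [folklore] -/
theorem prob_one_add_add_self_le (hd : 0 < d) (m : ℕ) (x : Site d) :
    prob d (1 + (m + m)) x ≤ prob d (m + m) 0 := by
  unfold prob
  have h2d : (0 : ℝ) < 2 * d := by positivity
  rw [div_le_div_iff₀ (by positivity) (by positivity), pow_add (2 * d : ℝ) 1 (m + m), pow_one]
  have h := count_one_add_add_self_le (d := d) m x
  have h' : (count d (1 + (m + m)) x : ℝ) ≤ 2 * d * count d (m + m) 0 := by exact_mod_cast h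
  calc (count d (1 + (m + m)) x : ℝ) * (2 * d : ℝ) ^ (m + m)
      ≤ 2 * d * count d (m + m) 0 * (2 * d : ℝ) ^ (m + m) :=
        mul_le_mul_of_nonneg_right h' (by positivity)
    _ = count d (m + m) 0 * (2 * d * (2 * d : ℝ) ^ (m + m)) := by ring

/-- Monotonicity of the even return probabilities: `p_{2(k+j)}(0) ≤ p_{2k}(0)` (`d ≥ 1`).
[folklore] -/
theorem prob_add_add_le (hd : 0 < d) (k j : ℕ) :
    prob d (k + j + (k + j)) 0 ≤ prob d (k + k) 0 := by
  unfold prob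
  rw [div_le_div_iff₀ (by positivity) (by positivity)]
  have h := count_add_add_le (d := d) k j
  have h' : (count d (k + j + (k + j)) 0 : ℝ) ≤ (2 * d : ℝ) ^ (2 * j) * count d (k + k) 0 := by
    exact_mod_cast h
  calc (count d (k + j + (k + j)) 0 : ℝ) * (2 * d : ℝ) ^ (k + k)
      ≤ (2 * d : ℝ) ^ (2 * j) * count d (k + k) 0 * (2 * d : ℝ) ^ (k + k) :=
        mul_le_mul_of_nonneg_right h' (by positivity)
    _ = count d (k + k) 0 * (2 * d : ℝ) ^ (k + j + (k + j)) := by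
        rw [show k + j + (k + j) = 2 * j + (k + k) by ring, pow_add]; ring

/-- **`pₙ(x) ≤ p_{2k}(0)` whenever `2k ≤ n`** (`d ≥ 1`): the maximum principle combined with the
monotonicity of the even return probabilities. [folklore] -/
theorem prob_le_prob_even (hd : 0 < d) {n k : ℕ} (hk : 2 * k ≤ n) (x : Site d) :
    prob d n x ≤ prob d (k + k) 0 := by
  obtain ⟨j, hj⟩ : ∃ j, n = 2 * (k + j) ∨ n = 1 + 2 * (k + j) := by
    rcases Nat.even_or_odd n with ⟨r, hr⟩ | ⟨r, hr⟩
    · exact ⟨r - k, Or.inl (by omega)⟩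
    · exact ⟨r - k, Or.inr (by omega)⟩
  rcases hj with rfl | rfl
  · rw [two_mul]
    exact (prob_add_self_le _ x).trans (prob_add_add_le hd k j)
  · rw [two_mul]
    exact (prob_one_add_add_self_le hd _ x).trans (prob_add_add_le hd k j)

end SRW

end Literature.Probability.LatticeModels
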